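import Summits.ABC.StewartYu.DescentSetupQ
import Literature.NumberTheory.Transcendental.Waldschmidt1980EndgameCW
import HarnessLib

/-!
# Cell abc-stewartyu, WP-A3 (v): one step of the `2`-descent and the endgame, sign-free

`Summits/ABC/StewartYu/DescentStepQ.lean` — cell `abc-stewartyu` (HOME
`run/shared/lean/pub/abc-stewartyu/`, seat p3; the "copy-port" of `HOME/plan/PORT-MAP.md`
§0-ERRATUM, continued; theorems and one `Prop`-structure, no named fact), sequel to
`DescentSetupQ.lean`.

On the sign-free data `Q : SetupQ` (generators `αⱼ, θ ≠ 0` of either sign) with the SIGNED rational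
cores `Q.coreSum`, `Q.classVec` of `DescentSetupQ.lean` and the sign-blind boxes / re-indexing of the
flattening `Q.flat : CW77.Setup`:

* `SetupQ.Inv` — the induction invariant of the descent at level `J` (the tree's `CW77.Setup.Inv`
  with the signed `coreSum`): integers `p(u)` supported in the box of level `J`, not all zero,
  `|p(u)| ≤ P`, and `coreSum_{J,τ}(s) = 0` for all odd `s < 2ᴶ S₀`, `|τ| < T/2ᴶ`;
* `SetupQ.descent_algebra` — **the algebraic half of one step**, PLACE-FREE: from the invariant at
  level `J` and the vanishing of the CLASS SUMS `classVec_{J,τ,s} = 0` (odd `s < 2^{J+1} S₀`,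
  `|τ| < T/2^{J+1}`) to the invariant at level `J + 1`.  This is the tree's
  `CW77.Setup.descent_algebra` [cite: CijsouwWaldschmidt1977, §4 Step 2 (pp. 189–191)] with its
  hypothesis `φ_{J,τ}(s/2) = 0` replaced by what it was used for (`classVec = 0`, there obtained from
  the real square roots via `classVec_eq_zero`); in the `p`-adic proof the class sums are killed
  directly by the `p`-adic Liouville inequality (`PadicMultiquadraticLiouvilleSharp.lean`) and the
  linear independence of the `p`-adic root monomials (`PadicMultiquadratic.evL_ne_zero`), so neither
  positivity nor the Kummer condition enters THIS file.  Proof text: the tree's, verbatim up to names;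
* `SetupQ.coreSum_top_eq`, `SetupQ.w80_endgame` — Waldschmidt's asymmetric endgame at the top level
  `L_θ < 2^{J₀}` (the tree's `CW77.Setup.w80_endgame` [cite: Waldschmidt1980, §3.5 (p. 274)], whose
  abstract core `Waldschmidt1980.endgame` only needs `αⱼ ≠ 0`).

Everything is [folklore] (our own book-keeping on published arguments; nothing new is claimed).
-/

noncomputable section

open Finset Polynomial
open Literature.NumberTheory.Transcendental
open Literature.NumberTheory.Transcendental.CW77
open Literature.NumberTheory.Transcendental.CW77.Setup (Idx Tau tauNorm scale)

namespace Summit.ABC.StewartYu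

namespace SetupQ

variable (Q : SetupQ) {h Lb : ℕ}

/-! ### The invariant -/

/-- **The induction invariant of the descent at level `J`** (signed version of `CW77.Setup.Inv`):
integers `p(u)`, supported in the box of level `J`, not all zero, bounded by `P`, with the relations
`coreSum_{J,τ}(s) = 0` for all odd `s < 2ᴶ S₀` and `|τ| < T/2ᴶ`. [folklore] -/
structure Inv (J₀ : ℕ) (L : Fin Q.d → ℕ) (Lθ S₀ T : ℕ) (P : ℤ) (J : ℕ) (p : Idx Q.d h Lb → ℤ) : Prop where
  /-- support in the box of level `J` -/
  supp : ∀ u, p u ≠ 0 → u ∈ Q.flat.box (h := h) (Lb := Lb) L Lθ J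
  /-- not all zero -/
  nonzero : ∃ u, p u ≠ 0
  /-- the size bound -/
  bound : ∀ u, |p u| ≤ P
  /-- the relations -/
  rel : ∀ s, s < 2 ^ J * S₀ → Odd s → ∀ τ : Tau Q.d, tauNorm τ < T / 2 ^ J →
    Q.coreSum J₀ J (Q.flat.box (h := h) (Lb := Lb) L Lθ J) p τ s = 0

/-! ### One step of the descent: the algebra -/

/-- **Step 2, the algebraic half (place-free).** From the invariant at level `J` and the vanishing of
all class sums `classVec_{J,τ,s}` (`s` odd `< 2^{J+1} S₀`, `|τ| < T/2^{J+1}`) to the invariant at level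
`J + 1`: choose `u₀` with `p(u₀) ≠ 0`, let `(ε, ε_θ)` be its residues mod `2`, re-index the class of
`u₀` by `λ = ε + 2μ` (`p'(v) = p(ε + 2v)`), pull the constant `2^{|τ'|} Kfac` out of `rHalf`, and
recentre the binomials `(γⱼ + cⱼ)^{τ'ⱼ}` (`CW77.sum_mul_prod_pow_eq_zero_of_shift`).
[folklore] -/
theorem descent_algebra {J₀ J : ℕ} {L : Fin Q.d → ℕ} {Lθ S₀ T : ℕ} {P : ℤ}
    {p : Idx Q.d h Lb → ℤ} (inv : Q.Inv J₀ L Lθ S₀ T P J p)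
    (half : ∀ s, s < 2 ^ (J + 1) * S₀ → Odd s → ∀ τ : Tau Q.d, tauNorm τ < T / 2 ^ (J + 1) →
      Q.classVec J₀ J (Q.flat.box (h := h) (Lb := Lb) L Lθ J) p τ s = 0) :
    ∃ p' : Idx Q.d h Lb → ℤ, Q.Inv J₀ L Lθ S₀ T P (J + 1) p' := by
  classical
  obtain ⟨u₀, hu₀⟩ := inv.nonzero
  set ε : Fin Q.d → ℕ := fun j => u₀.2.1 j % 2 with hεdef
  set εθ : ℕ := u₀.2.2 % 2 with hεθdef
  have hε : ∀ j, ε j ≤ 1 := fun j => by simp only [hεdef]; omega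
  have hεθ : εθ ≤ 1 := by simp only [hεθdef]; omega
  set p' : Idx Q.d h Lb → ℤ := fun v => p (Q.flat.reidx ε εθ v) with hp'
  set boxJ := Q.flat.box (h := h) (Lb := Lb) L Lθ J with hboxJ
  set boxJ1 := Q.flat.box (h := h) (Lb := Lb) L Lθ (J + 1) with hboxJ1
  refine ⟨p', ⟨?_, ?_, ?_, ?_⟩⟩
  · -- support
    intro v hv
    exact Q.flat.mem_box_succ_of_reidx (inv.supp _ hv)
  · -- not all zero
    refine ⟨Q.flat.halve u₀, ?_⟩
    simp only [hp']
    rw [Q.flat.reidx_halve u₀ (fun j => rfl) rfl]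
    exact hu₀
  · -- bound
    intro v; exact inv.bound _
  · -- the relations at level `J + 1`
    intro s hs hodd τ hτ
    -- the class sums of the residue class `(ε, εθ)` vanish
    have hcv : ∀ τ' : Fin Q.d → ℕ, τ.1 + ∑ j, τ' j < T / 2 ^ (J + 1) →
        Q.classVec J₀ J boxJ p (τ.1, τ') s (Q.flat.Tpat ε εθ) = 0 := by
      intro τ' hτ'
      have h0 := half s hs hodd (τ.1, τ') (by unfold tauNorm; exact hτ')
      exact congrFun h0 _
    -- the set of new unknowns coming from old ones
    set Vs := boxJ1.filter fun v => Q.flat.reidx ε εθ v ∈ boxJ with hVs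
    set W : Idx Q.d h Lb → ℚ := fun v => (p' v : ℚ) * (Q.flat.qΔ J₀ (J + 1) v τ.1 s * Q.qE v s) with hW
    -- the shifted relations
    have hshift : ∀ τ' : Fin Q.d → ℕ, ∑ j, τ' j < T / 2 ^ (J + 1) - τ.1 →
        ∑ v ∈ Vs, W v * ∏ j, (Q.flat.γ v j + Q.flat.cγ ε εθ j) ^ τ' j = 0 := by
      intro τ' hτ'
      have h1 := hcv τ' (by omega)
      unfold classVec at h1
      rw [Q.flat.sum_class_eq_sum_reidx hodd hε hεθ L Lθ J] at h1
      -- `h1 : ∑ v ∈ Vs, p (reidx v) * rHalf (reidx v) = 0`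
      simp_rw [Q.rHalf_reidx] at h1
      have hK : (2 : ℚ) ^ (∑ j, τ' j) * Q.Kfac ε εθ s ≠ 0 :=
        mul_ne_zero (pow_ne_zero _ two_ne_zero) (Q.Kfac_ne ε εθ s)
      have h2 : ∑ v ∈ Vs, (p (Q.flat.reidx ε εθ v) : ℚ) *
          ((2 : ℚ) ^ (∑ j, τ' j) * Q.Kfac ε εθ s * ((Q.flat.qΔ J₀ (J + 1) v τ.1 s * Q.qE v s) *
            ∏ j, (Q.flat.γ v j + Q.flat.cγ ε εθ j) ^ τ' j)) =
          ((2 : ℚ) ^ (∑ j, τ' j) * Q.Kfac ε εθ s) *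
            ∑ v ∈ Vs, W v * ∏ j, (Q.flat.γ v j + Q.flat.cγ ε εθ j) ^ τ' j := by
        rw [mul_sum]
        refine sum_congr rfl fun v _ => ?_
        simp only [hW, hp']; ring
      rw [h2] at h1
      exact (mul_eq_zero.mp h1).resolve_left hK
    -- recentring
    have hrel := sum_mul_prod_pow_eq_zero_of_shift (d := Q.d) Vs W (fun v j => Q.flat.γ v j)
      (Q.flat.cγ ε εθ) _ hshift τ.2 (by unfold tauNorm at hτ; omega)
    -- `coreSum_{J+1} = ∑_{Vs} W ∏ γ^τ'`
    have hcore : Q.coreSum J₀ (J + 1) boxJ1 p' τ s = ∑ v ∈ Vs, W v * ∏ j, Q.flat.γ v j ^ τ.2 j := by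
      unfold coreSum
      rw [hVs, sum_filter]
      refine sum_congr rfl fun v hv => ?_
      by_cases hvb : Q.flat.reidx ε εθ v ∈ boxJ
      · rw [if_pos hvb]
        unfold qTerm CW77.Setup.qA
        simp only [hW]; ring
      · rw [if_neg hvb]
        have : p' v = 0 := by
          simp only [hp']
          by_contra hne
          exact hvb (inv.supp _ hne)
        rw [this]; simp
    rw [hcore]; exact hrel

/-! ### The top level: Waldschmidt's asymmetric endgame -/

/-- At `λ_θ = 0` the signed `qE` is `∏ⱼ αⱼ^{λⱼ s}`. [folklore] -/
theorem qE_of_zero (ρ : Fin h × Fin Lb) (lam : Fin Q.d → ℕ) (s : ℕ) :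
    Q.qE ((ρ, (lam, 0)) : Idx Q.d h Lb) s = ∏ j, Q.α j ^ (lam j * s) := by
  unfold qE; simp

/-- **The signed rational core at the top level, as a double sum over `ρ` and the box
`∏ⱼ [0, ⌊Lⱼ/2^{J₀}⌋]`** (`L_θ < 2^{J₀}`, so `λ_θ = 0`, `γⱼ = λⱼ`):
`coreSum_{J₀,τ}(s) = τ₀! ∑_ρ ∑_λ p(ρ,λ,0) ((1/τ₀!)d^{τ₀}w_ρ)(s) ∏ⱼ (αⱼ^{sλⱼ} λⱼ^{τⱼ})`
(the tree's `CW77.Setup.coreSum_top_eq`, signs allowed). [folklore] -/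
theorem coreSum_top_eq {L : Fin Q.d → ℕ} {Lθ J₀ : ℕ} (hLθ : Lθ < 2 ^ J₀)
    (p : Idx Q.d h Lb → ℤ) (τ : Tau Q.d) (s : ℕ) :
    Q.coreSum J₀ J₀ (Q.flat.box (h := h) (Lb := Lb) L Lθ J₀) p τ s =
      (τ.1.factorial : ℚ) * ∑ ρ : Fin h × Fin Lb, ∑ lam : ∀ j : Fin Q.d, Fin (L j / 2 ^ J₀ + 1),
        (p (ρ, (fun j => ((lam j : ℕ)), 0)) : ℚ) *
          (hasseDeriv τ.1 (Waldschmidt1980.wPolyQ (ρ.1 : ℕ) (ρ.2 : ℕ) h)).eval (s : ℚ) *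
          ∏ j, ((Q.α j) ^ (s * (lam j : ℕ)) * (((lam j : ℕ) : ℚ)) ^ (τ.2 j)) := by
  classical
  unfold coreSum CW77.Setup.box
  rw [Nat.div_eq_of_lt hLθ, zero_add, Finset.sum_product, Finset.mul_sum]
  refine Finset.sum_congr rfl fun ρ _ => ?_
  rw [Finset.sum_product, Finset.mul_sum]
  simp only [Finset.sum_range_one]
  -- the sum over `piFinset` as a sum over the dependent box
  symm
  refine Finset.sum_bij' (fun lam _ => fun j => ((lam j : ℕ)))
    (fun μ hμ => fun j => ⟨μ j, mem_range.mp (Fintype.mem_piFinset.mp hμ j)⟩) ?_ ?_ ?_ ?_ ?_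
  · intro lam _; exact Fintype.mem_piFinset.mpr fun j => mem_range.mpr (lam j).isLt
  · intro μ _; exact mem_univ _
  · intro lam _; rfl
  · intro μ _; rfl
  · intro lam _
    unfold qTerm CW77.Setup.qA CW77.Setup.γ
    rw [Q.flat.qΔ_top_eq, Q.qE_of_zero]
    simp only [Nat.cast_zero, zero_mul, add_zero]
    rw [Finset.prod_mul_distrib]
    have hcomm : ∀ j : Fin Q.d, (Q.α j) ^ ((lam j : ℕ) * s) = (Q.α j) ^ (s * (lam j : ℕ)) := by
      intro j; rw [mul_comm]
    simp_rw [hcomm]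
    ring

/-- **Waldschmidt 1980, §3.5 — the contradiction at the top of the descent (signs allowed).** If the
invariant holds at the level `J₀` where the range of the eliminated exponent is empty (`L_θ < 2^{J₀}`),
the derivative budget `⌊T/2^{J₀}⌋` covers `τ₀ < T'`, `τⱼ ≤ ⌊Lⱼ/2^{J₀}⌋`, and
`h · Lb < T' · #{odd s < 2^{J₀} S₀}`, then all `p(u)` vanish — contradiction
(`Waldschmidt1980.endgame`, which needs only `αⱼ ≠ 0`). [folklore] -/
theorem w80_endgame {J₀ : ℕ} {L : Fin Q.d → ℕ} {Lθ S₀ T : ℕ} {P : ℤ} {p : Idx Q.d h Lb → ℤ}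
    (inv : Q.Inv J₀ L Lθ S₀ T P J₀ p) (hLθ : Lθ < 2 ^ J₀) {T' : ℕ}
    (hT' : T' + ∑ j, L j / 2 ^ J₀ ≤ T / 2 ^ J₀)
    (hcount : h * Lb < T' * ((range (2 ^ J₀ * S₀)).filter Odd).card) : False := by
  classical
  set L' : Fin Q.d → ℕ := fun j => L j / 2 ^ J₀ with hL'
  set boxJ := Q.flat.box (h := h) (Lb := Lb) L Lθ J₀ with hboxJ
  set pts : Finset ℕ := (range (2 ^ J₀ * S₀)).filter Odd with hpts
  set p' : (Fin h × Fin Lb) → (∀ j : Fin Q.d, Fin (L' j + 1)) → ℚ :=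
    fun ρ lam => (p (ρ, (fun j => ((lam j : ℕ)), 0)) : ℚ) with hp'
  -- the vanishing in the form of `Waldschmidt1980.endgame`
  have hvan : ∀ s ∈ pts, ∀ k < T', ∀ τb : ∀ j : Fin Q.d, Fin (L' j + 1),
      ∑ ρ : Fin h × Fin Lb, ∑ lam : ∀ j : Fin Q.d, Fin (L' j + 1),
        p' ρ lam * (hasseDeriv k (Waldschmidt1980.wPolyQ (ρ.1 : ℕ) (ρ.2 : ℕ) h)).eval ((fun n : ℕ => (n : ℚ)) s) *
          ∏ j, ((Q.α j) ^ (s * (lam j : ℕ)) * (((lam j : ℕ) : ℚ)) ^ ((τb j : ℕ))) = 0 := by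
    intro s hs k hk τb
    rw [hpts, mem_filter, mem_range] at hs
    set τ : Tau Q.d := (k, fun j => (τb j : ℕ)) with hτ
    have hτn : tauNorm τ < T / 2 ^ J₀ := by
      show k + ∑ j, (τb j : ℕ) < T / 2 ^ J₀
      have hle : ∑ j, (τb j : ℕ) ≤ ∑ j, L' j :=
        Finset.sum_le_sum fun j _ => Nat.lt_succ_iff.mp (τb j).isLt
      have hT'' : T' + ∑ j, L' j ≤ T / 2 ^ J₀ := hT'
      omega
    have hrel := inv.rel s hs.1 hs.2 τ hτn
    rw [Q.coreSum_top_eq hLθ p τ s] at hrel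
    have hk0 : (k.factorial : ℚ) ≠ 0 := by exact_mod_cast (Nat.factorial_pos k).ne'
    have h0 := (mul_eq_zero.mp hrel).resolve_left hk0
    simpa [hp', hτ] using h0
  have hend := Waldschmidt1980.endgame (K := ℚ) (fun ρ : Fin h × Fin Lb => Waldschmidt1980.wPolyQ (ρ.1 : ℕ) (ρ.2 : ℕ) h)
    (fun ρ => Waldschmidt1980.wPolyQ_ne_zero _ _ _) (CW77.Setup.injective_natDegree_wPolyQ h Lb) (N := h * Lb)
    (fun ρ => by
      rw [Waldschmidt1980.natDegree_wPolyQ]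
      have h1 := ρ.1.isLt; have h2 := ρ.2.isLt
      have h3 : ((ρ.2 : ℕ) + 1) * h = (ρ.2 : ℕ) * h + h := by ring
      have h4 : ((ρ.2 : ℕ) + 1) * h ≤ Lb * h := Nat.mul_le_mul_right h h2
      rw [mul_comm h Lb]; omega)
    L' (fun j => Q.α j) (fun j => Q.α_ne j) pts (fun n : ℕ => (n : ℚ))
    (fun a _ b _ hab => Nat.cast_injective (R := ℚ) hab) T' hcount p' hvan
  -- all `p(u)` vanish
  apply (inv.nonzero).elim
  intro u hu
  by_cases hmem : u ∈ boxJ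
  · rw [Q.flat.mem_box_top_iff hLθ] at hmem
    obtain ⟨hμ, hθ⟩ := hmem
    have hlam : p' u.1 (fun j => ⟨u.2.1 j, Nat.lt_succ_of_le (hμ j)⟩) = 0 := by
      rw [hend]; rfl
    simp only [hp'] at hlam
    have hu_eq : u = (u.1, (fun j => u.2.1 j, 0)) := by
      rcases u with ⟨ρ, μ, lθ⟩
      simp only at hθ ⊢
      rw [hθ]
    rw [hu_eq] at hu
    exact hu (by exact_mod_cast hlam)
  · exact hmem (inv.supp u hu)

end SetupQ

end Summit.ABC.StewartYu

end
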